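import Summits.Ventures.HodgeRepro2.T5RecordSphericalSpectrumSevenToy
import Summits.Ventures.HodgeRepro2.T5CyclotomicSevenInertPrime

/-!
# The unramified spectrum of the record's pair on `ℚ(ζ₇)` at EVERY inert place of order `6`: `q = p³`

Tier-5 support N3 / §G-N4.2 (seat p3, gen 86). File 347 read file 344's unramified-spectrum theorem on the field of
record `ℚ(ζ₇)` at the inert place `(3)` (`q = 27`). This file reads it at EVERY place `vPrime K p h6` of `ℚ(ζ₇)⁺`
above a rational prime `p` of order `6` modulo `7` (`p ≡ 3, 5 (mod 7)`: `3, 5, 17, 19, 31, …`; the places of file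
`T5CyclotomicSevenInertPrime`, which stay prime in `ℚ(ζ₇)` with `N(v) = p³`), so that the Satake parameter reads
`α · (p³)⁻² = α / p⁶`, and at `p = 5` as a numeral (`q = 125`, `α / 15625`):

* `absNorm_vPrime_cast` — `N(vPrime) = p³` in any field `k`;
* **`exists_mulEquiv_forall_nonempty_equiv_inertSphericalQuot_record_seven_inert`** — for any seventh cyclotomic
  extension `K`, any prime `p` of order `6` mod `7`, any datum `(θ, y)` and any generators `l`: `u₀`,
  `Φ : U(J₃(u₀)) ≃* U(1 ⊗ H₀)` matching the hyperspecial subgroups, a star-fixed uniformiser `ϖ'`, and every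
  irreducible `K_v`-finite representation of `U(1 ⊗ H₀)` with non-zero finite-dimensional `K_v`-invariants
  `≅ (inertSphericalQuot (α · ((p³)²)⁻¹)) ∘ Φ⁻¹` for some `α ≠ 0`;
* **`…_record_seven_five`** — at `p = 5` with `q = 125` (`[Fact (Nat.Prime 5)]` a section instance, inhabited by
  `T5CyclotomicSevenInertPrime.fact_prime_five`);
* **`…_record_seven_five_K7`** — on p1's `K7 = CyclotomicField 7 ℚ` with the explicit datum `(−7, √−7)`.

§8(d): uses an L-value-free non-vanishing device: NO.
-/

open Matrix NumberField NumberField.IsCMField IsDedekindDomain IsDedekindDomain.HeightOneSpectrum Module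
  MulAction
open scoped TensorProduct Pointwise
open Summit.Ventures.HodgeRepro2.T5UnitaryGroupForm Summit.Ventures.HodgeRepro2.T5UnitaryHeckeAdjoint
  Summit.Ventures.HodgeRepro2.T5HeckePermutationModule Summit.Ventures.HodgeRepro2.LevelPositivity
  Summit.Ventures.HodgeRepro2.T5LevelIdempotent Summit.Ventures.HodgeRepro2.T5StarOfInvolution
  Summit.Ventures.HodgeRepro2.T5FinitePlaceCM Summit.Ventures.HodgeRepro2.T5NonSplitPlaceUnitaryGroup
  Summit.Ventures.HodgeRepro2.T5RecordHyperspecial Summit.Ventures.HodgeRepro2.T5GlobalLatticeAlmostAll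
  Summit.Ventures.HodgeRepro2.T5HermitianThreeElements Summit.Ventures.HodgeRepro2.T5GaloisCartanThree
  Summit.Ventures.HodgeRepro2.T5InertDegreeGalois Summit.Ventures.HodgeRepro2.T5InertPlaceCompletion
  Summit.Ventures.HodgeRepro2.T5InertDegreeAdicCompletion Summit.Ventures.HodgeRepro2.T5InertSatakeTransform
  Summit.Ventures.HodgeRepro2.T5InertSatakeTransformCompletion Summit.Ventures.HodgeRepro2.T5InertUnipotentResidue
  Summit.Ventures.HodgeRepro2.T5InertSphericalSubquotient Summit.Ventures.HodgeRepro2.T5RecordSatakeCell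
  Summit.Ventures.HodgeRepro2.T5SplitPlaceUnitaryGroup Summit.Ventures.HodgeRepro2.T5FinitePlaceNormIndex
  Summit.Ventures.HodgeRepro2.T5HermitianLocalIsotropyN3 Summit.Ventures.HodgeRepro2.T5FinitePlaceSplitClassification
  Summit.Ventures.HodgeRepro2.T5InertDegreeCompletion Summit.Ventures.HodgeRepro2.T5InertPlaceCompletionCells
  Summit.Ventures.HodgeRepro2.T5RecordSatake Summit.Ventures.HodgeRepro2.T5CartanCellsDistinct
  Summit.Ventures.HodgeRepro2.T5RecordSatakeInert Summit.Ventures.HodgeRepro2.T5InertGlobalPrime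
  Summit.Ventures.HodgeRepro2.T5CMFieldSquareDatum Summit.Ventures.HodgeRepro2.T5RecordSatakeDegree
  Summit.Ventures.HodgeRepro2.T5RecordSatakeDegreeIntrinsic Summit.Ventures.HodgeRepro2.T5RecordSphericalSpectrum
  Summit.Ventures.HodgeRepro2.T5RecordSphericalSpectrumIntrinsic Summit.Ventures.HodgeRepro2.T5RecordSatakeToy
  Summit.Ventures.HodgeRepro2.T5CyclotomicSevenInertThree Summit.Ventures.HodgeRepro2.T5CyclotomicSevenNonDyadic
  Summit.Ventures.HodgeRepro2.CyclotomicSeven Summit.Ventures.HodgeRepro2.T5RecordSphericalSpectrumSevenToy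
  Summit.Ventures.HodgeRepro2.T5CyclotomicSevenInertPrime

namespace Summit.Ventures.HodgeRepro2.T5RecordSphericalSpectrumSevenInertPrime

universe uV

section Generic

variable (K : Type*) [Field K] [CharZero K] [IsCyclotomicExtension {7} ℚ K] [NumberField K] [IsCMField K]
variable (p : ℕ) [hp : Fact p.Prime] (h6 : orderOf (p : ZMod 7) = 6)
variable {θ : maximalRealSubfield K} {y : K}
  (hθ : algebraMap (maximalRealSubfield K) K θ = y ^ 2) (hy : complexConj K y ≠ y)
variable {r : ℕ} (l : Fin r → 𝓞 K) (k : Type*) [Field k] [CharZero k] [IsAlgClosed k]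

omit [IsCMField K] [CharZero k] [IsAlgClosed k] in
/-- `N(vPrime) = p³` read in any field `k`. -/
theorem absNorm_vPrime_cast : (Ideal.absNorm (vPrime K p h6).asIdeal : k) = (p : k) ^ 3 := by
  have h : Ideal.absNorm (vPrime K p h6).asIdeal = p ^ 3 := absNorm_vPrime K p h6
  rw [h]
  push_cast
  rfl

include hθ hy in
/-- **THE UNRAMIFIED SPECTRUM OF THE RECORD'S PAIR ON `ℚ(ζ₇)` AT EVERY INERT PLACE OF ORDER `6`, `q = p³`** (file 344's
`exists_mulEquiv_forall_nonempty_equiv_inertSphericalQuot_record_of_staysPrime` with `hmap := map_vPrime`,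
`H := H₀ = diag(1, 1, −1)`, `q' = p³`): for any prime `p` with `orderOf (p : ZMod 7) = 6`, any datum `(θ, y)` and
any generators `l`: `u₀ ∈ 𝒪_{K⁺_v}ˣ`, `Φ : U(J₃(u₀)) ≃* U(1 ⊗ H₀)` matching the hyperspecial subgroups, a star-fixed
uniformiser `ϖ'` of `𝒪_{K_w}`, and every irreducible `K_v`-finite representation of `U(1 ⊗ H₀)` with non-zero
finite-dimensional `K_v`-invariants `≅ (inertSphericalQuot (α · ((p³)²)⁻¹)) ∘ Φ⁻¹` for some `α ≠ 0`. -/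
theorem exists_mulEquiv_forall_nonempty_equiv_inertSphericalQuot_record_seven_inert
    (hl : Submodule.span (𝓞 (maximalRealSubfield K)) (Set.range l) = ⊤) :
    letI := tensorStarRing K (vPrime K p h6)
    letI := starRingOfQuadratic (finrank_eq_two K (vPrime K p h6) (wPrime K p h6) hθ hy
        (not_isSquare_of_staysPrime K (vPrime K p h6) (wPrime K p h6) hθ hy (map_vPrime K p h6)))
      (localConj (vPrime K p h6) (wPrime K p h6) hθ.symm (span_pair_eq_top K hy)
        (not_isSquare_of_staysPrime K (vPrime K p h6) (wPrime K p h6) hθ hy (map_vPrime K p h6))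
        (complexConj K))
      (localConj_ne_one (vPrime K p h6) (wPrime K p h6) hθ.symm (span_pair_eq_top K hy)
        (not_isSquare_of_staysPrime K (vPrime K p h6) (wPrime K p h6) hθ hy (map_vPrime K p h6))
        (complexConj K) (complexConj_apply_eq_neg K hθ hy))
    haveI := isDiscreteValuationRing_integralClosure_adicCompletion (vPrime K p h6) (wPrime K p h6)
    haveI := finite_residueField_integralClosure_adicCompletion (vPrime K p h6) (wPrime K p h6)
    haveI : IsFractionRing (integralClosure ((vPrime K p h6).adicCompletionIntegers (maximalRealSubfield K))
        ((wPrime K p h6).adicCompletion K)) ((wPrime K p h6).adicCompletion K) :=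
      integralClosure.isFractionRing_of_finite_extension ((vPrime K p h6).adicCompletion (maximalRealSubfield K))
        ((wPrime K p h6).adicCompletion K)
    ∃ (u₀ : ((vPrime K p h6).adicCompletionIntegers (maximalRealSubfield K))ˣ)
      (Φ : ↥(formUnitaryGroup (J3 (algebraMap ((vPrime K p h6).adicCompletionIntegers (maximalRealSubfield K))
        ((wPrime K p h6).adicCompletion K)
        (u₀ : (vPrime K p h6).adicCompletionIntegers (maximalRealSubfield K))))) ≃*
        ↥(formUnitaryGroup (tensorGram K (vPrime K p h6) (gramToy K))))
      (ϖ' : integralClosure ((vPrime K p h6).adicCompletionIntegers (maximalRealSubfield K))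
        ((wPrime K p h6).adicCompletion K))
      (hϖ' : Irreducible ϖ')
      (hs' : star (algebraMap (integralClosure ((vPrime K p h6).adicCompletionIntegers (maximalRealSubfield K))
        ((wPrime K p h6).adicCompletion K)) ((wPrime K p h6).adicCompletion K) ϖ') =
          algebraMap (integralClosure ((vPrime K p h6).adicCompletionIntegers (maximalRealSubfield K))
            ((wPrime K p h6).adicCompletion K)) ((wPrime K p h6).adicCompletion K) ϖ'),
      (∀ g, g ∈ hyperspecialSubgroup
          (integralClosure ((vPrime K p h6).adicCompletionIntegers (maximalRealSubfield K))
            ((wPrime K p h6).adicCompletion K))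
          (J3 (algebraMap ((vPrime K p h6).adicCompletionIntegers (maximalRealSubfield K))
            ((wPrime K p h6).adicCompletion K)
            (u₀ : (vPrime K p h6).adicCompletionIntegers (maximalRealSubfield K)))) ↔
          Φ g ∈ recordHyperspecial K (vPrime K p h6) l (gramToy K)) ∧
      ∀ {V : Type uV} [AddCommGroup V] [Module k V]
        (ρ : Representation k (↥(formUnitaryGroup (tensorGram K (vPrime K p h6) (gramToy K)))) V) [ρ.IsIrreducible],
        KFinite ρ (recordHyperspecial K (vPrime K p h6) l (gramToy K)) →
        ∀ [FiniteDimensional k (invariants ρ (recordHyperspecial K (vPrime K p h6) l (gramToy K)))],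
        invariants ρ (recordHyperspecial K (vPrime K p h6) l (gramToy K)) ≠ ⊥ →
        ∃ α : k, α ≠ 0 ∧ Nonempty (ρ.Equiv (comp Φ.symm
          (inertSphericalQuot
            (hstar_of_star_eq (localConj (vPrime K p h6) (wPrime K p h6) hθ.symm (span_pair_eq_top K hy)
              (not_isSquare_of_staysPrime K (vPrime K p h6) (wPrime K p h6) hθ hy (map_vPrime K p h6))
              (complexConj K))
              (fun x => by
                rw [star_p8_eq_star K (vPrime K p h6) (wPrime K p h6) hθ hy
                  (not_isSquare_of_staysPrime K (vPrime K p h6) (wPrime K p h6) hθ hy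
                    (map_vPrime K p h6))]
                rfl))
            (algebraMap ((vPrime K p h6).adicCompletionIntegers (maximalRealSubfield K))
              ((wPrime K p h6).adicCompletion K)
              (u₀ : (vPrime K p h6).adicCompletionIntegers (maximalRealSubfield K)))
            (star_algebraMap_of_star_eq (localConj (vPrime K p h6) (wPrime K p h6) hθ.symm
              (span_pair_eq_top K hy)
              (not_isSquare_of_staysPrime K (vPrime K p h6) (wPrime K p h6) hθ hy (map_vPrime K p h6))
              (complexConj K))
              (fun x => by
                rw [star_p8_eq_star K (vPrime K p h6) (wPrime K p h6) hθ hy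
                  (not_isSquare_of_staysPrime K (vPrime K p h6) (wPrime K p h6) hθ hy
                    (map_vPrime K p h6))]
                rfl)
              (u₀ : (vPrime K p h6).adicCompletionIntegers (maximalRealSubfield K)))
            (algebraMap_unit_ne_zero (F := (vPrime K p h6).adicCompletion (maximalRealSubfield K)) u₀)
            (isInteger_algebraMap (u₀ : (vPrime K p h6).adicCompletionIntegers (maximalRealSubfield K)))
            (isInteger_algebraMap_unit_inv u₀) hϖ' hs' k (α * (((p : k) ^ 3) ^ 2)⁻¹)))) :=
  exists_mulEquiv_forall_nonempty_equiv_inertSphericalQuot_record_of_staysPrime K (vPrime K p h6)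
    (wPrime K p h6) hθ hy (map_vPrime K p h6) l k ((p : k) ^ 3) (absNorm_vPrime_cast K p h6 k) hl
    gramToy_isHermitian isUnit_det_gramToy (notMem_badSet_gramToy _)

end Generic

section Five

variable (K : Type*) [Field K] [CharZero K] [IsCyclotomicExtension {7} ℚ K] [NumberField K] [IsCMField K]
variable [Fact (Nat.Prime 5)]
variable {θ : maximalRealSubfield K} {y : K}
  (hθ : algebraMap (maximalRealSubfield K) K θ = y ^ 2) (hy : complexConj K y ≠ y)
variable {r : ℕ} (l : Fin r → 𝓞 K) (k : Type*) [Field k] [CharZero k] [IsAlgClosed k]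

omit [IsCMField K] [CharZero k] [IsAlgClosed k] in
/-- `N(vPrime 5) = 125` read in any field `k`. -/
theorem absNorm_vPrime_five_cast :
    (Ideal.absNorm (vPrime K 5 orderOf_natCast_five_zmod_seven).asIdeal : k) = 125 := by
  have h : Ideal.absNorm (vPrime K 5 orderOf_natCast_five_zmod_seven).asIdeal = 125 := absNorm_vPrime_five K
  rw [h]
  norm_num

include hθ hy in
/-- **THE UNRAMIFIED SPECTRUM ON `ℚ(ζ₇)` AT THE INERT PLACE `(5)`, `q = 125`**: the Satake parameter reads
`α · (125²)⁻¹ = α / 15625`. -/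
theorem exists_mulEquiv_forall_nonempty_equiv_inertSphericalQuot_record_seven_five
    (hl : Submodule.span (𝓞 (maximalRealSubfield K)) (Set.range l) = ⊤) :
    letI := tensorStarRing K (vPrime K 5 orderOf_natCast_five_zmod_seven)
    letI := starRingOfQuadratic (finrank_eq_two K (vPrime K 5 orderOf_natCast_five_zmod_seven) (wPrime K 5 orderOf_natCast_five_zmod_seven) hθ hy
        (not_isSquare_of_staysPrime K (vPrime K 5 orderOf_natCast_five_zmod_seven) (wPrime K 5 orderOf_natCast_five_zmod_seven) hθ hy (map_vPrime K 5 orderOf_natCast_five_zmod_seven)))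
      (localConj (vPrime K 5 orderOf_natCast_five_zmod_seven) (wPrime K 5 orderOf_natCast_five_zmod_seven) hθ.symm (span_pair_eq_top K hy)
        (not_isSquare_of_staysPrime K (vPrime K 5 orderOf_natCast_five_zmod_seven) (wPrime K 5 orderOf_natCast_five_zmod_seven) hθ hy (map_vPrime K 5 orderOf_natCast_five_zmod_seven))
        (complexConj K))
      (localConj_ne_one (vPrime K 5 orderOf_natCast_five_zmod_seven) (wPrime K 5 orderOf_natCast_five_zmod_seven) hθ.symm (span_pair_eq_top K hy)
        (not_isSquare_of_staysPrime K (vPrime K 5 orderOf_natCast_five_zmod_seven) (wPrime K 5 orderOf_natCast_five_zmod_seven) hθ hy (map_vPrime K 5 orderOf_natCast_five_zmod_seven))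
        (complexConj K) (complexConj_apply_eq_neg K hθ hy))
    haveI := isDiscreteValuationRing_integralClosure_adicCompletion (vPrime K 5 orderOf_natCast_five_zmod_seven) (wPrime K 5 orderOf_natCast_five_zmod_seven)
    haveI := finite_residueField_integralClosure_adicCompletion (vPrime K 5 orderOf_natCast_five_zmod_seven) (wPrime K 5 orderOf_natCast_five_zmod_seven)
    haveI : IsFractionRing (integralClosure ((vPrime K 5 orderOf_natCast_five_zmod_seven).adicCompletionIntegers (maximalRealSubfield K))
        ((wPrime K 5 orderOf_natCast_five_zmod_seven).adicCompletion K)) ((wPrime K 5 orderOf_natCast_five_zmod_seven).adicCompletion K) :=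
      integralClosure.isFractionRing_of_finite_extension ((vPrime K 5 orderOf_natCast_five_zmod_seven).adicCompletion (maximalRealSubfield K))
        ((wPrime K 5 orderOf_natCast_five_zmod_seven).adicCompletion K)
    ∃ (u₀ : ((vPrime K 5 orderOf_natCast_five_zmod_seven).adicCompletionIntegers (maximalRealSubfield K))ˣ)
      (Φ : ↥(formUnitaryGroup (J3 (algebraMap ((vPrime K 5 orderOf_natCast_five_zmod_seven).adicCompletionIntegers (maximalRealSubfield K))
        ((wPrime K 5 orderOf_natCast_five_zmod_seven).adicCompletion K)
        (u₀ : (vPrime K 5 orderOf_natCast_five_zmod_seven).adicCompletionIntegers (maximalRealSubfield K))))) ≃*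
        ↥(formUnitaryGroup (tensorGram K (vPrime K 5 orderOf_natCast_five_zmod_seven) (gramToy K))))
      (ϖ' : integralClosure ((vPrime K 5 orderOf_natCast_five_zmod_seven).adicCompletionIntegers (maximalRealSubfield K))
        ((wPrime K 5 orderOf_natCast_five_zmod_seven).adicCompletion K))
      (hϖ' : Irreducible ϖ')
      (hs' : star (algebraMap (integralClosure ((vPrime K 5 orderOf_natCast_five_zmod_seven).adicCompletionIntegers (maximalRealSubfield K))
        ((wPrime K 5 orderOf_natCast_five_zmod_seven).adicCompletion K)) ((wPrime K 5 orderOf_natCast_five_zmod_seven).adicCompletion K) ϖ') =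
          algebraMap (integralClosure ((vPrime K 5 orderOf_natCast_five_zmod_seven).adicCompletionIntegers (maximalRealSubfield K))
            ((wPrime K 5 orderOf_natCast_five_zmod_seven).adicCompletion K)) ((wPrime K 5 orderOf_natCast_five_zmod_seven).adicCompletion K) ϖ'),
      (∀ g, g ∈ hyperspecialSubgroup
          (integralClosure ((vPrime K 5 orderOf_natCast_five_zmod_seven).adicCompletionIntegers (maximalRealSubfield K))
            ((wPrime K 5 orderOf_natCast_five_zmod_seven).adicCompletion K))
          (J3 (algebraMap ((vPrime K 5 orderOf_natCast_five_zmod_seven).adicCompletionIntegers (maximalRealSubfield K))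
            ((wPrime K 5 orderOf_natCast_five_zmod_seven).adicCompletion K)
            (u₀ : (vPrime K 5 orderOf_natCast_five_zmod_seven).adicCompletionIntegers (maximalRealSubfield K)))) ↔
          Φ g ∈ recordHyperspecial K (vPrime K 5 orderOf_natCast_five_zmod_seven) l (gramToy K)) ∧
      ∀ {V : Type uV} [AddCommGroup V] [Module k V]
        (ρ : Representation k (↥(formUnitaryGroup (tensorGram K (vPrime K 5 orderOf_natCast_five_zmod_seven) (gramToy K)))) V) [ρ.IsIrreducible],
        KFinite ρ (recordHyperspecial K (vPrime K 5 orderOf_natCast_five_zmod_seven) l (gramToy K)) →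
        ∀ [FiniteDimensional k (invariants ρ (recordHyperspecial K (vPrime K 5 orderOf_natCast_five_zmod_seven) l (gramToy K)))],
        invariants ρ (recordHyperspecial K (vPrime K 5 orderOf_natCast_five_zmod_seven) l (gramToy K)) ≠ ⊥ →
        ∃ α : k, α ≠ 0 ∧ Nonempty (ρ.Equiv (comp Φ.symm
          (inertSphericalQuot
            (hstar_of_star_eq (localConj (vPrime K 5 orderOf_natCast_five_zmod_seven) (wPrime K 5 orderOf_natCast_five_zmod_seven) hθ.symm (span_pair_eq_top K hy)
              (not_isSquare_of_staysPrime K (vPrime K 5 orderOf_natCast_five_zmod_seven) (wPrime K 5 orderOf_natCast_five_zmod_seven) hθ hy (map_vPrime K 5 orderOf_natCast_five_zmod_seven))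
              (complexConj K))
              (fun x => by
                rw [star_p8_eq_star K (vPrime K 5 orderOf_natCast_five_zmod_seven) (wPrime K 5 orderOf_natCast_five_zmod_seven) hθ hy
                  (not_isSquare_of_staysPrime K (vPrime K 5 orderOf_natCast_five_zmod_seven) (wPrime K 5 orderOf_natCast_five_zmod_seven) hθ hy
                    (map_vPrime K 5 orderOf_natCast_five_zmod_seven))]
                rfl))
            (algebraMap ((vPrime K 5 orderOf_natCast_five_zmod_seven).adicCompletionIntegers (maximalRealSubfield K))
              ((wPrime K 5 orderOf_natCast_five_zmod_seven).adicCompletion K)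
              (u₀ : (vPrime K 5 orderOf_natCast_five_zmod_seven).adicCompletionIntegers (maximalRealSubfield K)))
            (star_algebraMap_of_star_eq (localConj (vPrime K 5 orderOf_natCast_five_zmod_seven) (wPrime K 5 orderOf_natCast_five_zmod_seven) hθ.symm
              (span_pair_eq_top K hy)
              (not_isSquare_of_staysPrime K (vPrime K 5 orderOf_natCast_five_zmod_seven) (wPrime K 5 orderOf_natCast_five_zmod_seven) hθ hy (map_vPrime K 5 orderOf_natCast_five_zmod_seven))
              (complexConj K))
              (fun x => by
                rw [star_p8_eq_star K (vPrime K 5 orderOf_natCast_five_zmod_seven) (wPrime K 5 orderOf_natCast_five_zmod_seven) hθ hy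
                  (not_isSquare_of_staysPrime K (vPrime K 5 orderOf_natCast_five_zmod_seven) (wPrime K 5 orderOf_natCast_five_zmod_seven) hθ hy
                    (map_vPrime K 5 orderOf_natCast_five_zmod_seven))]
                rfl)
              (u₀ : (vPrime K 5 orderOf_natCast_five_zmod_seven).adicCompletionIntegers (maximalRealSubfield K)))
            (algebraMap_unit_ne_zero (F := (vPrime K 5 orderOf_natCast_five_zmod_seven).adicCompletion (maximalRealSubfield K)) u₀)
            (isInteger_algebraMap (u₀ : (vPrime K 5 orderOf_natCast_five_zmod_seven).adicCompletionIntegers (maximalRealSubfield K)))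
            (isInteger_algebraMap_unit_inv u₀) hϖ' hs' k (α * ((125 : k) ^ 2)⁻¹)))) :=
  exists_mulEquiv_forall_nonempty_equiv_inertSphericalQuot_record_of_staysPrime K
    (vPrime K 5 orderOf_natCast_five_zmod_seven) (wPrime K 5 orderOf_natCast_five_zmod_seven) hθ hy
    (map_vPrime K 5 orderOf_natCast_five_zmod_seven) l k 125 (absNorm_vPrime_five_cast K k) hl
    gramToy_isHermitian isUnit_det_gramToy (notMem_badSet_gramToy _)

end Five

section FieldOfRecord

variable [Fact (Nat.Prime 5)] {r : ℕ} (l : Fin r → 𝓞 K7) (k : Type*) [Field k] [CharZero k] [IsAlgClosed k]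

/-- **THE UNRAMIFIED SPECTRUM ON THE FIELD OF RECORD `K7 = ℚ(ζ₇)` AT `(5)` WITH THE EXPLICIT DATUM `(−7, √−7)`**:
every `K_{(5)}`-spherical irreducible of `(U(1 ⊗ H₀), K_{(5)})` is `≅ (inertSphericalQuot (α · (125²)⁻¹)) ∘ Φ⁻¹` for
some `α ≠ 0`. -/
theorem exists_mulEquiv_forall_nonempty_equiv_inertSphericalQuot_record_seven_five_K7
    (hl : Submodule.span (𝓞 (maximalRealSubfield K7)) (Set.range l) = ⊤) :
    letI := tensorStarRing K7 (vPrime K7 5 orderOf_natCast_five_zmod_seven)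
    letI := starRingOfQuadratic (finrank_eq_two K7 (vPrime K7 5 orderOf_natCast_five_zmod_seven) (wPrime K7 5 orderOf_natCast_five_zmod_seven) neg_seven_eq_sqrtNegSeven_sq complexConj_sqrtNegSeven_ne
        (not_isSquare_of_staysPrime K7 (vPrime K7 5 orderOf_natCast_five_zmod_seven) (wPrime K7 5 orderOf_natCast_five_zmod_seven) neg_seven_eq_sqrtNegSeven_sq complexConj_sqrtNegSeven_ne (map_vPrime K7 5 orderOf_natCast_five_zmod_seven)))
      (localConj (vPrime K7 5 orderOf_natCast_five_zmod_seven) (wPrime K7 5 orderOf_natCast_five_zmod_seven) neg_seven_eq_sqrtNegSeven_sq.symm (span_pair_eq_top K7 complexConj_sqrtNegSeven_ne)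
        (not_isSquare_of_staysPrime K7 (vPrime K7 5 orderOf_natCast_five_zmod_seven) (wPrime K7 5 orderOf_natCast_five_zmod_seven) neg_seven_eq_sqrtNegSeven_sq complexConj_sqrtNegSeven_ne (map_vPrime K7 5 orderOf_natCast_five_zmod_seven))
        (complexConj K7))
      (localConj_ne_one (vPrime K7 5 orderOf_natCast_five_zmod_seven) (wPrime K7 5 orderOf_natCast_five_zmod_seven) neg_seven_eq_sqrtNegSeven_sq.symm (span_pair_eq_top K7 complexConj_sqrtNegSeven_ne)
        (not_isSquare_of_staysPrime K7 (vPrime K7 5 orderOf_natCast_five_zmod_seven) (wPrime K7 5 orderOf_natCast_five_zmod_seven) neg_seven_eq_sqrtNegSeven_sq complexConj_sqrtNegSeven_ne (map_vPrime K7 5 orderOf_natCast_five_zmod_seven))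
        (complexConj K7) (complexConj_apply_eq_neg K7 neg_seven_eq_sqrtNegSeven_sq complexConj_sqrtNegSeven_ne))
    haveI := isDiscreteValuationRing_integralClosure_adicCompletion (vPrime K7 5 orderOf_natCast_five_zmod_seven) (wPrime K7 5 orderOf_natCast_five_zmod_seven)
    haveI := finite_residueField_integralClosure_adicCompletion (vPrime K7 5 orderOf_natCast_five_zmod_seven) (wPrime K7 5 orderOf_natCast_five_zmod_seven)
    haveI : IsFractionRing (integralClosure ((vPrime K7 5 orderOf_natCast_five_zmod_seven).adicCompletionIntegers (maximalRealSubfield K7))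
        ((wPrime K7 5 orderOf_natCast_five_zmod_seven).adicCompletion K7)) ((wPrime K7 5 orderOf_natCast_five_zmod_seven).adicCompletion K7) :=
      integralClosure.isFractionRing_of_finite_extension ((vPrime K7 5 orderOf_natCast_five_zmod_seven).adicCompletion (maximalRealSubfield K7))
        ((wPrime K7 5 orderOf_natCast_five_zmod_seven).adicCompletion K7)
    ∃ (u₀ : ((vPrime K7 5 orderOf_natCast_five_zmod_seven).adicCompletionIntegers (maximalRealSubfield K7))ˣ)
      (Φ : ↥(formUnitaryGroup (J3 (algebraMap ((vPrime K7 5 orderOf_natCast_five_zmod_seven).adicCompletionIntegers (maximalRealSubfield K7))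
        ((wPrime K7 5 orderOf_natCast_five_zmod_seven).adicCompletion K7)
        (u₀ : (vPrime K7 5 orderOf_natCast_five_zmod_seven).adicCompletionIntegers (maximalRealSubfield K7))))) ≃*
        ↥(formUnitaryGroup (tensorGram K7 (vPrime K7 5 orderOf_natCast_five_zmod_seven) (gramToy K7))))
      (ϖ' : integralClosure ((vPrime K7 5 orderOf_natCast_five_zmod_seven).adicCompletionIntegers (maximalRealSubfield K7))
        ((wPrime K7 5 orderOf_natCast_five_zmod_seven).adicCompletion K7))
      (hϖ' : Irreducible ϖ')
      (hs' : star (algebraMap (integralClosure ((vPrime K7 5 orderOf_natCast_five_zmod_seven).adicCompletionIntegers (maximalRealSubfield K7))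
        ((wPrime K7 5 orderOf_natCast_five_zmod_seven).adicCompletion K7)) ((wPrime K7 5 orderOf_natCast_five_zmod_seven).adicCompletion K7) ϖ') =
          algebraMap (integralClosure ((vPrime K7 5 orderOf_natCast_five_zmod_seven).adicCompletionIntegers (maximalRealSubfield K7))
            ((wPrime K7 5 orderOf_natCast_five_zmod_seven).adicCompletion K7)) ((wPrime K7 5 orderOf_natCast_five_zmod_seven).adicCompletion K7) ϖ'),
      (∀ g, g ∈ hyperspecialSubgroup
          (integralClosure ((vPrime K7 5 orderOf_natCast_five_zmod_seven).adicCompletionIntegers (maximalRealSubfield K7))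
            ((wPrime K7 5 orderOf_natCast_five_zmod_seven).adicCompletion K7))
          (J3 (algebraMap ((vPrime K7 5 orderOf_natCast_five_zmod_seven).adicCompletionIntegers (maximalRealSubfield K7))
            ((wPrime K7 5 orderOf_natCast_five_zmod_seven).adicCompletion K7)
            (u₀ : (vPrime K7 5 orderOf_natCast_five_zmod_seven).adicCompletionIntegers (maximalRealSubfield K7)))) ↔
          Φ g ∈ recordHyperspecial K7 (vPrime K7 5 orderOf_natCast_five_zmod_seven) l (gramToy K7)) ∧
      ∀ {V : Type uV} [AddCommGroup V] [Module k V]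
        (ρ : Representation k (↥(formUnitaryGroup (tensorGram K7 (vPrime K7 5 orderOf_natCast_five_zmod_seven) (gramToy K7)))) V) [ρ.IsIrreducible],
        KFinite ρ (recordHyperspecial K7 (vPrime K7 5 orderOf_natCast_five_zmod_seven) l (gramToy K7)) →
        ∀ [FiniteDimensional k (invariants ρ (recordHyperspecial K7 (vPrime K7 5 orderOf_natCast_five_zmod_seven) l (gramToy K7)))],
        invariants ρ (recordHyperspecial K7 (vPrime K7 5 orderOf_natCast_five_zmod_seven) l (gramToy K7)) ≠ ⊥ →
        ∃ α : k, α ≠ 0 ∧ Nonempty (ρ.Equiv (comp Φ.symm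
          (inertSphericalQuot
            (hstar_of_star_eq (localConj (vPrime K7 5 orderOf_natCast_five_zmod_seven) (wPrime K7 5 orderOf_natCast_five_zmod_seven) neg_seven_eq_sqrtNegSeven_sq.symm (span_pair_eq_top K7 complexConj_sqrtNegSeven_ne)
              (not_isSquare_of_staysPrime K7 (vPrime K7 5 orderOf_natCast_five_zmod_seven) (wPrime K7 5 orderOf_natCast_five_zmod_seven) neg_seven_eq_sqrtNegSeven_sq complexConj_sqrtNegSeven_ne (map_vPrime K7 5 orderOf_natCast_five_zmod_seven))
              (complexConj K7))
              (fun x => by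
                rw [star_p8_eq_star K7 (vPrime K7 5 orderOf_natCast_five_zmod_seven) (wPrime K7 5 orderOf_natCast_five_zmod_seven) neg_seven_eq_sqrtNegSeven_sq complexConj_sqrtNegSeven_ne
                  (not_isSquare_of_staysPrime K7 (vPrime K7 5 orderOf_natCast_five_zmod_seven) (wPrime K7 5 orderOf_natCast_five_zmod_seven) neg_seven_eq_sqrtNegSeven_sq complexConj_sqrtNegSeven_ne
                    (map_vPrime K7 5 orderOf_natCast_five_zmod_seven))]
                rfl))
            (algebraMap ((vPrime K7 5 orderOf_natCast_five_zmod_seven).adicCompletionIntegers (maximalRealSubfield K7))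
              ((wPrime K7 5 orderOf_natCast_five_zmod_seven).adicCompletion K7)
              (u₀ : (vPrime K7 5 orderOf_natCast_five_zmod_seven).adicCompletionIntegers (maximalRealSubfield K7)))
            (star_algebraMap_of_star_eq (localConj (vPrime K7 5 orderOf_natCast_five_zmod_seven) (wPrime K7 5 orderOf_natCast_five_zmod_seven) neg_seven_eq_sqrtNegSeven_sq.symm
              (span_pair_eq_top K7 complexConj_sqrtNegSeven_ne)
              (not_isSquare_of_staysPrime K7 (vPrime K7 5 orderOf_natCast_five_zmod_seven) (wPrime K7 5 orderOf_natCast_five_zmod_seven) neg_seven_eq_sqrtNegSeven_sq complexConj_sqrtNegSeven_ne (map_vPrime K7 5 orderOf_natCast_five_zmod_seven))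
              (complexConj K7))
              (fun x => by
                rw [star_p8_eq_star K7 (vPrime K7 5 orderOf_natCast_five_zmod_seven) (wPrime K7 5 orderOf_natCast_five_zmod_seven) neg_seven_eq_sqrtNegSeven_sq complexConj_sqrtNegSeven_ne
                  (not_isSquare_of_staysPrime K7 (vPrime K7 5 orderOf_natCast_five_zmod_seven) (wPrime K7 5 orderOf_natCast_five_zmod_seven) neg_seven_eq_sqrtNegSeven_sq complexConj_sqrtNegSeven_ne
                    (map_vPrime K7 5 orderOf_natCast_five_zmod_seven))]
                rfl)
              (u₀ : (vPrime K7 5 orderOf_natCast_five_zmod_seven).adicCompletionIntegers (maximalRealSubfield K7)))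
            (algebraMap_unit_ne_zero (F := (vPrime K7 5 orderOf_natCast_five_zmod_seven).adicCompletion (maximalRealSubfield K7)) u₀)
            (isInteger_algebraMap (u₀ : (vPrime K7 5 orderOf_natCast_five_zmod_seven).adicCompletionIntegers (maximalRealSubfield K7)))
            (isInteger_algebraMap_unit_inv u₀) hϖ' hs' k (α * ((125 : k) ^ 2)⁻¹)))) :=
  exists_mulEquiv_forall_nonempty_equiv_inertSphericalQuot_record_seven_five K7 neg_seven_eq_sqrtNegSeven_sq
    complexConj_sqrtNegSeven_ne l k hl

end FieldOfRecord

end Summit.Ventures.HodgeRepro2.T5RecordSphericalSpectrumSevenInertPrime
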